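import Mathlib.Analysis.Normed.Algebra.Spectrum
import Mathlib.Analysis.Normed.Module.RieszLemma
import Mathlib.Analysis.SpecificLimits.Normed
import Literature.Analysis.OperatorTheory.CompactPerturbationSpectrum
import HarnessLib

/-!
# Quasi-compact operators: the spectrum outside the essential radius is a finite set of
  eigenvalues, and there is a spectrum-free annulus

Analysis/OperatorTheory proofs-layer file (theorems only, no definitions, no named facts).

Let `m = s + k` be a bounded operator on a complex Banach space with `k` compact and `s`
power-dominated by a geometric sequence, `‖sⁿ‖ ≤ C θ₀ⁿ` (so the essential spectral radius of `m`
is at most `θ₀`; this is the "quasi-compact" situation of Ionescu-Tulcea–Marinescu / Hennion, and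
of every period map of a dissipative semilinear evolution). We prove, WITHOUT the analytic
Fredholm theorem:

* `mem_resolventSet_of_norm_pow_le`: `‖aⁿ‖ ≤ C θⁿ` and `θ < |z|` give `z ∈ ρ(a)` (spectral mapping
  for powers, `spectrum.pow_mem_pow`);
* `mem_resolventSet_or_exists_eigenvector_of_add_compact`: for `z ∈ ρ(s)`, either `z ∈ ρ(s + k)`
  or `z` is an eigenvalue of `s + k` (Fredholm alternative for the compact `R_s(z) k`, Mathlib's
  `IsCompactOperator.hasEigenvalue_or_mem_resolventSet` through the tree's
  `isUnit_one_sub_or_exists_fixed_of_isCompactOperator`);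
* `finite_setOf_hasEigenvalue_norm_le`: for `θ₀ < θ₁` the eigenvalues of `m` with `|μ| ≥ θ₁` form a
  finite set — F. Riesz's argument: an infinite sequence of them gives, by Riesz's lemma in the
  increasing chain of the (invariant) spans of eigenvectors, unit-size vectors `yₙ` at distance
  `≥ 1` from the previous span; with `N` so large that `‖s^N‖ θ₁^{-N}` is small, the compact
  operator `m^N − s^N` maps the bounded vectors `μₙ^{-N} yₙ` to a `1/2`-separated sequence,
  contradicting compactness;
* `exists_annulus_subset_resolventSet_of_add_compact`: hence for `θ₀ < θ₁ < θ₂` there is a closed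
  annulus `a ≤ |z| ≤ b`, `θ₁ < a < b < θ₂`, contained in `ρ(m) ∩ ρ(s)`.

These are the inputs of the Riesz-projection splitting of a quasi-compact operator at a
non-resonant radius (Kato 1966, III-§6.4; used for pseudo-stable manifolds of maps whose
derivative is "contraction + compact").

## References

* T. Kato, *Perturbation Theory for Linear Operators*, Springer 1966, III-§6.4–6.5, III-§6.7
  Thm. 6.26 (Riesz theory of compact operators). [Kato1966]
* M. Reed, B. Simon, *Methods of Modern Mathematical Physics I*, §VI.5 (Riesz–Schauder).
  [ReedSimonI1980]
-/

noncomputable section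

namespace Literature.Analysis.OperatorTheory

open _root_.Filter _root_.Topology _root_.Set _root_.Metric

/-! ### Power-dominated elements: the resolvent set contains `{|z| > θ}` -/

section PowerBound

variable {A : Type*} [NormedRing A] [NormedAlgebra ℂ A] [CompleteSpace A]

/-- **Spectral radius of a power-dominated element**: if `‖aⁿ‖ ≤ C θⁿ` for all `n` (`0 ≤ θ`) and
`θ < |z|`, then `z ∈ ρ(a)`. (If `z ∈ σ(a)` then `zⁿ ∈ σ(aⁿ)`, so `|z|ⁿ ≤ ‖aⁿ‖ ‖1‖ ≤ C ‖1‖ θⁿ`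
for all `n`, impossible.) [folklore] -/
theorem mem_resolventSet_of_norm_pow_le {a : A} {C θ : ℝ} (hθ : 0 ≤ θ)
    (ha : ∀ n : ℕ, ‖a ^ n‖ ≤ C * θ ^ n) {z : ℂ} (hz : θ < ‖z‖) : z ∈ resolventSet ℂ a := by
  by_contra hzρ
  have hzσ : z ∈ spectrum ℂ a := by
    by_contra h
    exact hzρ (spectrum.mem_resolventSet_iff.2 (not_not.1 (mt spectrum.mem_iff.2 h)))
  have hz0 : 0 < ‖z‖ := hθ.trans_lt hz
  have hC : 0 ≤ C * ‖(1 : A)‖ := by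
    have h0 := ha 0
    rw [pow_zero, pow_zero, mul_one] at h0
    exact mul_nonneg ((norm_nonneg _).trans h0) (norm_nonneg _)
  -- `|z|ⁿ ≤ C ‖1‖ θⁿ`
  have hpow : ∀ n : ℕ, ‖z‖ ^ n ≤ C * ‖(1 : A)‖ * θ ^ n := fun n => by
    have h1 := spectrum.norm_le_norm_mul_of_mem (spectrum.pow_mem_pow a n hzσ)
    rw [norm_pow] at h1
    calc ‖z‖ ^ n ≤ ‖a ^ n‖ * ‖(1 : A)‖ := h1
      _ ≤ C * θ ^ n * ‖(1 : A)‖ := by gcongr; exact ha n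
      _ = C * ‖(1 : A)‖ * θ ^ n := by ring
  set q : ℝ := θ / ‖z‖ with hq
  have hq0 : 0 ≤ q := div_nonneg hθ hz0.le
  have hq1 : q < 1 := (div_lt_one hz0).2 hz
  obtain ⟨n, hn⟩ := exists_pow_lt_of_lt_one (show (0 : ℝ) < 1 / (C * ‖(1 : A)‖ + 1) by positivity)
    hq1
  have hθq : θ ^ n = q ^ n * ‖z‖ ^ n := by
    rw [hq, div_pow, div_mul_cancel₀ _ (pow_ne_zero n hz0.ne')]
  have h2 := hpow n
  rw [hθq, ← mul_assoc] at h2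
  have h3 : C * ‖(1 : A)‖ * q ^ n < 1 := by
    calc C * ‖(1 : A)‖ * q ^ n ≤ C * ‖(1 : A)‖ * (1 / (C * ‖(1 : A)‖ + 1)) := by gcongr
      _ < 1 := by rw [mul_one_div, div_lt_one (by positivity)]; linarith
  have h4 : ‖z‖ ^ n ≤ C * ‖(1 : A)‖ * q ^ n * ‖z‖ ^ n := h2
  have h5 : 0 < ‖z‖ ^ n := pow_pos hz0 n
  nlinarith

/-- The circle, and indeed everything outside radius `θ`, lies in `ρ(a)` when `‖aⁿ‖ ≤ C θⁿ`:
annulus form. [folklore] -/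
theorem annulus_subset_resolventSet_of_norm_pow_le {a : A} {C θ : ℝ} (hθ : 0 ≤ θ)
    (ha : ∀ n : ℕ, ‖a ^ n‖ ≤ C * θ ^ n) {r R : ℝ} (hr : θ < r) :
    closedBall (0 : ℂ) R \ ball 0 r ⊆ resolventSet ℂ a := fun z hz =>
  mem_resolventSet_of_norm_pow_le hθ ha (hr.trans_le (by
    have h := hz.2; rw [mem_ball, dist_zero_right, not_lt] at h; exact h))

end PowerBound

/-! ### Compact perturbations: resolvent set or eigenvalue -/

section Compact

variable {X : Type*} [NormedAddCommGroup X] [NormedSpace ℂ X] [CompleteSpace X]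

/-- **Fredholm alternative off `σ(s)`**: if `k` is compact and `z ∈ ρ(s)`, then either
`z ∈ ρ(s + k)` or `z` is an eigenvalue of `s + k` with a non-zero eigenvector
(`z − (s + k) = (z − s)(1 − R_s(z) k)` and the Fredholm alternative for the compact `R_s(z) k`;
Reed–Simon I, §VI.5). [cite: ReedSimonI1980, §VI.5, Corollary to Thm. VI.14] -/
theorem mem_resolventSet_or_exists_eigenvector_of_add_compact (s k : X →L[ℂ] X)
    (hk : IsCompactOperator k) {z : ℂ} (hz : z ∈ resolventSet ℂ s) :
    z ∈ resolventSet ℂ (s + k) ∨ ∃ v : X, v ≠ 0 ∧ (s + k) v = z • v := by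
  rcases isUnit_one_sub_or_exists_fixed_of_isCompactOperator
      (isCompactOperator_resolvent_mul s hk z) with h | ⟨ψ, hψ0, hψ⟩
  · exact Or.inl ((mem_resolventSet_add_iff s k hz).2 h)
  · exact Or.inr ⟨ψ, hψ0, apply_eq_smul_of_resolvent_mul_apply_eq s k hz hψ⟩

omit [CompleteSpace X] in
/-- `m^N − s^N` is compact when `m − s` is (`m^{N+1} − s^{N+1} = m (m^N − s^N) + (m − s) s^N`).
[folklore] -/
theorem isCompactOperator_pow_sub_pow {m s : X →L[ℂ] X}
    (hk : IsCompactOperator (m - s : X →L[ℂ] X)) (N : ℕ) :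
    IsCompactOperator (m ^ N - s ^ N : X →L[ℂ] X) := by
  induction N with
  | zero => simp only [pow_zero, sub_self]; exact isCompactOperator_zero
  | succ N ih =>
    have h1 : IsCompactOperator ((m * (m ^ N - s ^ N) : X →L[ℂ] X) : X → X) := ih.clm_comp m
    have h2 : IsCompactOperator (((m - s) * s ^ N : X →L[ℂ] X) : X → X) := hk.comp_clm (s ^ N)
    have heq : (m ^ (N + 1) - s ^ (N + 1) : X →L[ℂ] X) = m * (m ^ N - s ^ N) + (m - s) * s ^ N := by
      simp only [pow_succ', mul_sub, sub_mul]; abel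
    rw [heq]
    exact h1.add h2

/-! ### Finitely many eigenvalues outside the essential radius -/

omit [CompleteSpace X] in
/-- **Eigenvalues of a quasi-compact operator outside the essential radius are finite in number.**
Let `m, s` be bounded operators on a complex Banach space with `m − s` compact and
`‖sⁿ‖ ≤ C θ₀ⁿ`, and let `θ₀ < θ₁`. Then `{μ : θ₁ ≤ |μ|, μ eigenvalue of m}` is finite (F. Riesz's
argument with Riesz's lemma along the chain of spans of eigenvectors, applied to the compact
operator `m^N − s^N` for `N` large; Kato 1966, III-§6.7 Thm. 6.26 is the case `s = 0`).
[cite: Kato1966, III-§6.7 Thm. 6.26] -/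
theorem finite_setOf_hasEigenvalue_norm_le {m s : X →L[ℂ] X}
    (hk : IsCompactOperator (m - s : X →L[ℂ] X)) {C θ₀ θ₁ : ℝ} (hθ₀ : 0 ≤ θ₀) (hθ₁ : θ₀ < θ₁)
    (hs : ∀ n : ℕ, ‖s ^ n‖ ≤ C * θ₀ ^ n) :
    {μ : ℂ | θ₁ ≤ ‖μ‖ ∧ Module.End.HasEigenvalue (m : Module.End ℂ X) μ}.Finite := by
  by_contra hinf
  rw [← Set.not_infinite, not_not] at hinf
  have hθ₁0 : 0 < θ₁ := hθ₀.trans_lt hθ₁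
  have hC : 0 ≤ C := by
    have h0 := hs 0; rw [pow_zero, pow_zero, mul_one] at h0; exact (norm_nonneg _).trans h0
  -- an injective sequence of eigenvalues with eigenvectors
  set emb := hinf.natEmbedding
  let μ : ℕ → ℂ := fun n => (emb n : ℂ)
  have hμinj : Function.Injective μ := fun a b hab => emb.injective (Subtype.ext hab)
  have hμ : ∀ n, θ₁ ≤ ‖μ n‖ ∧ Module.End.HasEigenvalue (m : Module.End ℂ X) (μ n) :=
    fun n => (emb n).2
  have hμ0 : ∀ n, μ n ≠ 0 := fun n h => by
    have := (hμ n).1; rw [h, norm_zero] at this; exact absurd this (not_le.2 hθ₁0)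
  choose v hv using fun n => (hμ n).2.exists_hasEigenvector
  have hmv : ∀ n, m (v n) = μ n • v n := fun n => (hv n).apply_eq_smul
  have hli : LinearIndependent ℂ v :=
    Module.End.eigenvectors_linearIndependent' (m : Module.End ℂ X) μ hμinj v hv
  -- the chain of spans
  let F : ℕ → Submodule ℂ X := fun n => Submodule.span ℂ (v '' Iio n)
  have hFmono : ∀ {a b : ℕ}, a ≤ b → F a ≤ F b := fun hab =>
    Submodule.span_mono (image_mono (Iio_subset_Iio hab))
  have hvF : ∀ n, v n ∈ F (n + 1) := fun n =>
    Submodule.subset_span ⟨n, Nat.lt_succ_self n, rfl⟩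
  have hvnF : ∀ n, v n ∉ F n := fun n => hli.notMem_span_image (by simp)
  have hFclosed : ∀ n, IsClosed (F n : Set X) := fun n => by
    haveI : FiniteDimensional ℂ (F n) :=
      FiniteDimensional.span_of_finite ℂ ((finite_Iio n).image v)
    exact Submodule.closed_of_finiteDimensional _
  have hmF : ∀ n, ∀ x ∈ F n, m x ∈ F n := by
    intro n x hx
    have h : (F n).map (m : X →ₗ[ℂ] X) ≤ F n := by
      refine Submodule.map_span_le _ _ _ |>.2 ?_
      rintro _ ⟨i, hi, rfl⟩
      change m (v i) ∈ F n
      rw [hmv]; exact Submodule.smul_mem _ _ (Submodule.subset_span ⟨i, hi, rfl⟩)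
    exact h ⟨x, hx, rfl⟩
  -- `m y − μₙ y ∈ Fₙ` for `y ∈ Fₙ₊₁`, and the same for powers
  have hstep : ∀ n, ∀ y ∈ F (n + 1), m y - μ n • y ∈ F n := by
    intro n y hy
    have hy' : y ∈ Submodule.span ℂ (insert (v n) (v '' Iio n)) := by
      have : v '' Iio (n + 1) = insert (v n) (v '' Iio n) := by
        rw [← image_insert_eq]; congr 1; ext i; simp
      change y ∈ Submodule.span ℂ (v '' Iio (n + 1)) at hy
      rwa [this] at hy
    obtain ⟨c, f, hf, rfl⟩ := Submodule.mem_span_insert.1 hy'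
    have : m (c • v n + f) - μ n • (c • v n + f) = m f - μ n • f := by
      rw [map_add, map_smul, hmv, smul_add, smul_comm c (μ n) (v n)]; abel
    rw [this]
    exact Submodule.sub_mem _ (hmF n f hf) (Submodule.smul_mem _ _ hf)
  have hpowstep : ∀ N n, ∀ y ∈ F (n + 1), (m ^ N) y - μ n ^ N • y ∈ F n := by
    intro N n y hy
    induction N with
    | zero => simp
    | succ N ih =>
      have heq : (m ^ (N + 1)) y - μ n ^ (N + 1) • y =
          m ((m ^ N) y - μ n ^ N • y) + μ n ^ N • (m y - μ n • y) := by
        rw [pow_succ', mul_apply_eq_comp, map_sub, map_smul, smul_sub, smul_smul,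
          pow_succ]
        abel
      rw [heq]
      exact Submodule.add_mem _ (hmF n _ ih) (Submodule.smul_mem _ _ (hstep n y hy))
  have hpowF : ∀ N n, ∀ y ∈ F n, (m ^ N) y ∈ F n := by
    intro N n y hy
    induction N with
    | zero => simpa using hy
    | succ N ih => rw [pow_succ', mul_apply_eq_comp]; exact hmF n _ ih
  -- Riesz's lemma in `Fₙ₊₁` relative to `Fₙ`
  have hRiesz : ∀ n, ∃ y ∈ F (n + 1), ‖y‖ ≤ 3 ∧ ∀ f ∈ F n, 1 ≤ ‖y - f‖ := by
    intro n
    let G : Submodule ℂ (F (n + 1)) := (F n).comap (F (n + 1)).subtype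
    have hGc : IsClosed (G : Set (F (n + 1))) := (hFclosed n).preimage continuous_subtype_val
    have hG : ∃ x : F (n + 1), x ∉ G := ⟨⟨v n, hvF n⟩, hvnF n⟩
    obtain ⟨x₀, hx₀, hx₀'⟩ := riesz_lemma_of_norm_lt (c := (2 : ℂ)) (by norm_num)
      (R := 3) (by norm_num) hGc hG
    refine ⟨x₀, x₀.2, by simpa using hx₀, fun f hf => ?_⟩
    have := hx₀' ⟨f, hFmono (Nat.le_succ n) hf⟩ hf
    simpa using this
  choose y hyF hy3 hysep using hRiesz
  -- choose `N` with `3 C θ₀^N ≤ θ₁^N / 4`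
  obtain ⟨N, hN⟩ : ∃ N : ℕ, C * (θ₀ / θ₁) ^ N * 3 ≤ 1 / 4 := by
    have ht : Tendsto (fun N : ℕ => C * (θ₀ / θ₁) ^ N * 3) atTop (𝓝 (C * 0 * 3)) :=
      ((tendsto_pow_atTop_nhds_zero_of_lt_one (div_nonneg hθ₀ hθ₁0.le)
        ((div_lt_one hθ₁0).2 hθ₁)).const_mul C).mul_const 3
    rw [mul_zero, zero_mul] at ht
    exact (ht.eventually (ge_mem_nhds (by norm_num : (0 : ℝ) < 1 / 4))).exists
  -- the bounded vectors `wₙ = μₙ^{-N} yₙ`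
  let w : ℕ → X := fun n => (μ n ^ N)⁻¹ • y n
  have hwnorm : ∀ n, ‖w n‖ ≤ 3 * (θ₁ ^ N)⁻¹ := fun n => by
    change ‖(μ n ^ N)⁻¹ • y n‖ ≤ _
    rw [norm_smul, norm_inv, norm_pow, mul_comm]
    gcongr
    · exact hy3 n
    · exact (hμ n).1
  have hsw : ∀ n, ‖(s ^ N) (w n)‖ ≤ 1 / 4 := fun n => by
    calc ‖(s ^ N) (w n)‖ ≤ ‖s ^ N‖ * ‖w n‖ := (s ^ N).le_opNorm _
      _ ≤ C * θ₀ ^ N * (3 * (θ₁ ^ N)⁻¹) :=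
          mul_le_mul (hs N) (hwnorm n) (norm_nonneg _) ((norm_nonneg _).trans (hs N))
      _ = C * (θ₀ / θ₁) ^ N * 3 := by rw [div_pow]; ring
      _ ≤ 1 / 4 := hN
  -- separation of `(m^N − s^N) wₙ`
  have hmw : ∀ n, (m ^ N) (w n) - y n ∈ F n := fun n => by
    have h := Submodule.smul_mem (F n) (μ n ^ N)⁻¹ (hpowstep N n (y n) (hyF n))
    rwa [smul_sub, smul_smul, inv_mul_cancel₀ (pow_ne_zero N (hμ0 n)), one_smul, ← map_smul]
      at h
  have hsep : ∀ l n, l < n → 1 / 2 ≤ ‖(m ^ N - s ^ N) (w n) - (m ^ N - s ^ N) (w l)‖ := by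
    intro l n hln
    have hwl : (m ^ N) (w l) ∈ F n :=
      hFmono (Nat.succ_le_of_lt hln) (hpowF N (l + 1) _ (Submodule.smul_mem _ _ (hyF l)))
    set f : X := ((m ^ N) (w n) - y n) - (m ^ N) (w l) with hf
    have hfF : f ∈ F n := Submodule.sub_mem _ (hmw n) hwl
    have heq : (m ^ N - s ^ N) (w n) - (m ^ N - s ^ N) (w l) =
        (y n - (-f)) - (s ^ N) (w n) + (s ^ N) (w l) := by
      simp only [sub_apply, hf]; abel
    rw [heq]
    have h1 : 1 ≤ ‖y n - (-f)‖ := hysep n (-f) (Submodule.neg_mem _ hfF)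
    have h2 := norm_sub_le (y n - (-f) - (s ^ N) (w n) + (s ^ N) (w l)) ((s ^ N) (w l))
    have h3 := norm_sub_le (y n - (-f) - (s ^ N) (w n)) (-(s ^ N) (w n))
    rw [add_sub_cancel_right] at h2
    rw [sub_neg_eq_add, sub_add_cancel, norm_neg] at h3
    linarith [hsw n, hsw l]
  -- compactness of `m^N − s^N` gives a Cauchy subsequence: contradiction
  obtain ⟨K, hK, hKw⟩ := (isCompactOperator_pow_sub_pow hk N).image_closedBall_subset_compact
    (f := ((m ^ N - s ^ N : X →L[ℂ] X) : X →ₗ[ℂ] X)) (3 * (θ₁ ^ N)⁻¹)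
  obtain ⟨x, -, ψ, hψ, hψx⟩ := hK.tendsto_subseq
    (x := fun n => (m ^ N - s ^ N) (w n)) fun n => hKw ⟨w n, mem_closedBall_zero_iff.2 (hwnorm n), rfl⟩
  have hc := hψx.cauchySeq
  rw [Metric.cauchySeq_iff'] at hc
  obtain ⟨N₀, hN₀⟩ := hc (1 / 2) (by norm_num)
  have hlt := hN₀ (N₀ + 1) (Nat.le_succ _)
  rw [dist_eq_norm] at hlt
  exact (not_le.2 hlt) (hsep _ _ (hψ (Nat.lt_succ_self N₀)))

/-! ### A spectrum-free annulus -/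

/-- **A spectrum-free annulus below the unit circle for a quasi-compact operator.** If
`m = s + k` with `k` compact, `‖sⁿ‖ ≤ C θ₀ⁿ` (`0 ≤ θ₀`) and `θ₀ < θ₁ < θ₂`, then there are
`θ₁ < a < b < θ₂` such that the closed annulus `a ≤ |z| ≤ b` lies in `ρ(m)` (and in `ρ(s)`).
Indeed every `z` with `|z| > θ₀` is in `ρ(s)`, hence in `ρ(m)` unless it is an eigenvalue, and
the eigenvalues with `|μ| ≥ θ₁` are finitely many. [cite: Kato1966, III-§6.4 and III-§6.7] -/
theorem exists_annulus_subset_resolventSet_of_add_compact {m s k : X →L[ℂ] X} (hm : m = s + k)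
    (hk : IsCompactOperator k) {C θ₀ θ₁ θ₂ : ℝ} (hθ₀ : 0 ≤ θ₀) (h₁ : θ₀ < θ₁) (h₂ : θ₁ < θ₂)
    (hs : ∀ n : ℕ, ‖s ^ n‖ ≤ C * θ₀ ^ n) :
    ∃ a b : ℝ, θ₁ < a ∧ a < b ∧ b < θ₂ ∧ closedBall (0 : ℂ) b \ ball 0 a ⊆ resolventSet ℂ m ∧
      closedBall (0 : ℂ) b \ ball 0 a ⊆ resolventSet ℂ s := by
  have hk' : IsCompactOperator (m - s : X →L[ℂ] X) := by rwa [hm, add_sub_cancel_left]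
  have hfin := finite_setOf_hasEigenvalue_norm_le hk' hθ₀ h₁ hs
  set B : Set ℝ := (fun μ : ℂ => ‖μ‖) '' {μ : ℂ | θ₁ ≤ ‖μ‖ ∧
    Module.End.HasEigenvalue (m : Module.End ℂ X) μ} with hB
  have hBfin : B.Finite := hfin.image _
  have hU : IsOpen (Ioo θ₁ θ₂ \ B) := isOpen_Ioo.sdiff hBfin.isClosed
  obtain ⟨t, ht⟩ : (Ioo θ₁ θ₂ \ B).Nonempty := ((Ioo_infinite h₂).sdiff hBfin).nonempty
  obtain ⟨ε, hε, hball⟩ := Metric.isOpen_iff.1 hU t ht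
  refine ⟨t - ε / 2, t + ε / 2, ?_, by linarith, ?_, ?_,
    annulus_subset_resolventSet_of_norm_pow_le hθ₀ hs ?_⟩
  · have := (hball (mem_ball_self hε)).1.1
    have h' : t - ε / 2 ∈ ball t ε := by rw [mem_ball, Real.dist_eq, abs_lt]; constructor <;> linarith
    exact (hball h').1.1
  · have h' : t + ε / 2 ∈ ball t ε := by rw [mem_ball, Real.dist_eq, abs_lt]; constructor <;> linarith
    exact (hball h').1.2
  · intro z hz
    have hz1 : ‖z‖ ≤ t + ε / 2 := by simpa using hz.1
    have hz2 : t - ε / 2 ≤ ‖z‖ := by have := hz.2; rw [mem_ball, dist_zero_right, not_lt] at this; exact this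
    have hzU : ‖z‖ ∈ Ioo θ₁ θ₂ \ B := hball (by
      rw [mem_ball, Real.dist_eq, abs_lt]; constructor <;> linarith)
    have hzs : z ∈ resolventSet ℂ s :=
      mem_resolventSet_of_norm_pow_le hθ₀ hs (h₁.trans hzU.1.1)
    rcases mem_resolventSet_or_exists_eigenvector_of_add_compact s k hk hzs with h | ⟨v, hv0, hv⟩
    · rwa [hm]
    · exfalso
      refine hzU.2 ⟨z, ⟨hzU.1.1.le, ?_⟩, rfl⟩
      rw [hm]
      exact Module.End.hasEigenvalue_of_hasEigenvector ⟨Module.End.mem_eigenspace_iff.2 hv, hv0⟩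
  · have h' : t - ε / 2 ∈ ball t ε := by rw [mem_ball, Real.dist_eq, abs_lt]; constructor <;> linarith
    exact h₁.trans (hball h').1.1

end Compact

end Literature.Analysis.OperatorTheory
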